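import Summits.AtomisticToContinuum.HydrodynamicLimit.Theorems.AntiMazurCoboundariesCorrectorPressureDecayKiferTangent
import Literature.Analysis.FunctionSpaces.PointConfigVagueTopology
import Literature.Analysis.FluidPDE.HardSphereTorusMeasure
import Mathlib.MeasureTheory.Measure.Haar.Unique
import Mathlib.Topology.UrysohnsLemma

/-!
# Bias continuity along tangent states, IV: window bookkeeping on configurations

Helper file 4/5 of crux stmt-AtomisticToContinuum-14135 `AntiMazurCoboundaries.CorrectorPressureDecay`, line `FirstLemma` (idea `kifer-compactification`), registered stub `stub_tangentBias : TangentBias`;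
namespace `…Theorems.KiferCompactification` (wave-2 stub-worker B of lead a1, split by the lead). For a law `μ` on
`PointConfig (ℝ³ × ℝ³)` with finite mean number of particles above the unit cube, the unit-cube window functional
`windowSumReal ω [0,1)³ G` of a bounded continuous `G` is integrable and is approximated by the `C_c` linear
statistic `ω.sumFn (ψ ⊗ χ·G)` up to `K · (E_μ[#(shell S × ℝ³)] + E_μ[#([0,1)³ × {R < ‖v‖})])`
(`windowSum_approx`, registered as `stub_windowSum_approx`), where `ψ = 1` on the cube off the shell `S` and
`χ = 1` on the velocity ball of radius `R`.
-/


noncomputable section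

open MeasureTheory ProbabilityTheory Set Filter Topology
open scoped ENNReal

namespace Summit.AtomisticToContinuum.HydrodynamicLimit.Theorems.KiferCompactification

open Literature.MathematicalPhysics.KineticTheory (T3 V3 hsDiameter localGibbsLaw blowUpPoint hsDiameter_pos
  succ_mul_hsDiameter_pow_three localGibbsLaw_eq localGibbsMeasure localGibbsMeasure_univ posPartition
  posPartition_nonneg lintegral_localGibbsMeasure lintegral_posWeight_eq_one velMeasure zipConfig zipConfig_apply
  gaussMeasure lintegral_fintype_prod_eq_prod' canonicalPartition_eq_posPartition)
open Literature.MathematicalPhysics.KineticTheory.PointProcess (laplaceFunctional)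
open Literature.Analysis.FluidPDE (HardSphereFlow Config windowSumReal particlesIn particlesIn_eq mem_particlesIn_iff)
open Literature.Analysis.FluidPDE.Torus (reprSym symCube measurable_reprSym map_reprSym_volume proj_reprSym
  closedBall_subset_symCube)
open Literature.Analysis.FunctionSpaces (PointConfig)
open Literature.Analysis.FunctionSpaces.Torus (proj unitCube continuous_proj measurableSet_unitCube mem_unitCube)

/-! ## Window bookkeeping on configurations with finitely many particles above the cube -/

section Window

variable {ω : PointConfig (V3 × V3)}

/-- With finitely many particles above the cube, the window functional is a finite sum. -/
theorem windowSumReal_eq_sum (hP : (particlesIn ω (unitCube (Fin 3))).Finite) (G : V3 × V3 → ℝ) :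
    windowSumReal ω (unitCube (Fin 3)) G = ∑ p ∈ hP.toFinset, G p := by
  unfold windowSumReal
  rw [tsum_congr_set_coe G hP.coe_toFinset.symm, tsum_subtype, sum_eq_tsum_indicator]

/-- With finitely many particles above the cube, the linear statistic of a test function vanishing off the cube is
the same finite sum. -/
theorem sumFn_eq_sum_particlesIn (hP : (particlesIn ω (unitCube (Fin 3))).Finite) {u : V3 × V3 → ℝ}
    (hu : ∀ p, u p ≠ 0 → p.1 ∈ unitCube (Fin 3)) : ω.sumFn u = ∑ p ∈ hP.toFinset, u p := by
  rw [Literature.Analysis.FunctionSpaces.PointConfig.sumFn_def]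
  refine finsum_mem_eq_sum_of_subset u ?_ ?_
  · intro p hp
    rw [hP.coe_toFinset, mem_particlesIn_iff]
    exact ⟨hp.1, hu p hp.2⟩
  · intro p hp
    rw [hP.coe_toFinset, mem_particlesIn_iff] at hp
    exact hp.1

/-- With finitely many particles above the cube, `ℝ≥0∞`-valued sums over the configuration of functions vanishing off
the cube are finite sums. -/
theorem tsum_carrier_eq_sum (hP : (particlesIn ω (unitCube (Fin 3))).Finite) {f : V3 × V3 → ℝ≥0∞}
    (hf : ∀ p, f p ≠ 0 → p.1 ∈ unitCube (Fin 3)) :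
    ∑' p : (ω : Set (V3 × V3)), f p = ∑ p ∈ hP.toFinset, f p := by
  rw [tsum_subtype (ω : Set (V3 × V3)) f, tsum_eq_sum (s := hP.toFinset) fun p hp => ?_]
  · refine Finset.sum_congr rfl fun p hp => ?_
    rw [hP.mem_toFinset, mem_particlesIn_iff] at hp
    exact Set.indicator_of_mem hp.1 f
  · rw [hP.mem_toFinset, mem_particlesIn_iff, not_and] at hp
    by_cases hpω : p ∈ ω
    · rw [Set.indicator_of_mem hpω]
      by_contra hne
      exact hp hpω (hf p hne)
    · exact Set.indicator_of_notMem hpω f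

/-- With finitely many particles above the cube, counts of sets above the cube are cardinalities of filters of the
finite set of particles. -/
theorem count_eq_card_filter (hP : (particlesIn ω (unitCube (Fin 3))).Finite) {s : Set (V3 × V3)}
    [DecidablePred (· ∈ s)] (hs : ∀ p ∈ s, p.1 ∈ unitCube (Fin 3)) :
    ((ω.count s : ℕ∞) : ℝ≥0∞) = ((hP.toFinset.filter (· ∈ s)).card : ℝ≥0∞) := by
  have hset : (ω.carrier ∩ s) = ↑(hP.toFinset.filter (· ∈ s)) := by
    ext p
    simp only [Finset.coe_filter, Set.Finite.mem_toFinset, mem_particlesIn_iff, mem_inter_iff, mem_setOf_eq,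
      Literature.Analysis.FunctionSpaces.PointConfig.mem_carrier]
    exact ⟨fun h => ⟨⟨h.1, hs p h.2⟩, h.2⟩, fun h => ⟨h.1.1, h.2⟩⟩
  rw [Literature.Analysis.FunctionSpaces.PointConfig.count, hset, Set.encard_coe_eq_coe_finsetCard]
  simp

/-- Real form of `count_eq_card_filter`: the count is the sum of the indicator over the particles. -/
theorem toReal_count_eq_sum_indicator (hP : (particlesIn ω (unitCube (Fin 3))).Finite) {s : Set (V3 × V3)}
    (hs : ∀ p ∈ s, p.1 ∈ unitCube (Fin 3)) :
    (((ω.count s : ℕ∞) : ℝ≥0∞)).toReal = ∑ p ∈ hP.toFinset, s.indicator (fun _ => (1 : ℝ)) p := by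
  classical
  rw [count_eq_card_filter hP hs]
  simp only [ENNReal.toReal_natCast]
  rw [Finset.sum_congr rfl fun p _ => (Set.indicator_apply s (fun _ => (1 : ℝ)) p), Finset.sum_boole]

/-- A measurable version of "sum of `u` over the particles": difference of the `ℝ≥0∞` Campbell sums of the positive
and negative parts, read back in `ℝ`. -/
theorem measurable_tsum_posPart_sub {u : V3 × V3 → ℝ} (hu : Measurable u) :
    Measurable fun ω : PointConfig (V3 × V3) =>
      (∑' p : (ω : Set (V3 × V3)), ENNReal.ofReal (max (u p) 0)).toReal -
        (∑' p : (ω : Set (V3 × V3)), ENNReal.ofReal (max (-u p) 0)).toReal := by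
  have h1 : Measurable fun ω : PointConfig (V3 × V3) => ∑' p : (ω : Set (V3 × V3)), ENNReal.ofReal (max (u p) 0) :=
    Literature.Analysis.FunctionSpaces.PointConfig.measurable_tsum_carrier
      (f := fun q : PointConfig (V3 × V3) × (V3 × V3) => ENNReal.ofReal (max (u q.2) 0))
      ((hu.comp measurable_snd).max measurable_const).ennreal_ofReal measurable_id
  have h2 : Measurable fun ω : PointConfig (V3 × V3) =>
      ∑' p : (ω : Set (V3 × V3)), ENNReal.ofReal (max (-u p) 0) :=
    Literature.Analysis.FunctionSpaces.PointConfig.measurable_tsum_carrier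
      (f := fun q : PointConfig (V3 × V3) × (V3 × V3) => ENNReal.ofReal (max (-u q.2) 0))
      ((hu.comp measurable_snd).neg.max measurable_const).ennreal_ofReal measurable_id
  exact h1.ennreal_toReal.sub h2.ennreal_toReal

/-- On configurations with finitely many particles above the cube, the measurable version is the finite sum. -/
theorem tsum_posPart_sub_eq_sum (hP : (particlesIn ω (unitCube (Fin 3))).Finite) {u : V3 × V3 → ℝ}
    (hu : ∀ p, u p ≠ 0 → p.1 ∈ unitCube (Fin 3)) :
    (∑' p : (ω : Set (V3 × V3)), ENNReal.ofReal (max (u p) 0)).toReal -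
        (∑' p : (ω : Set (V3 × V3)), ENNReal.ofReal (max (-u p) 0)).toReal = ∑ p ∈ hP.toFinset, u p := by
  have hpos : ∀ p, ENNReal.ofReal (max (u p) 0) ≠ 0 → p.1 ∈ unitCube (Fin 3) := fun p hp =>
    hu p fun h0 => hp (by rw [h0, max_self, ENNReal.ofReal_zero])
  have hneg : ∀ p, ENNReal.ofReal (max (-u p) 0) ≠ 0 → p.1 ∈ unitCube (Fin 3) := fun p hp =>
    hu p fun h0 => hp (by rw [h0, neg_zero, max_self, ENNReal.ofReal_zero])
  rw [tsum_carrier_eq_sum hP hpos, tsum_carrier_eq_sum hP hneg,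
    ENNReal.toReal_sum fun p _ => ENNReal.ofReal_ne_top, ENNReal.toReal_sum fun p _ => ENNReal.ofReal_ne_top,
    ← Finset.sum_sub_distrib]
  refine Finset.sum_congr rfl fun p _ => ?_
  rw [ENNReal.toReal_ofReal (le_max_right _ _), ENNReal.toReal_ofReal (le_max_right _ _)]
  exact max_zero_sub_max_neg_zero_eq_self (u p)

end Window

/-- **Window functional versus `C_c` linear statistics (deterministic bookkeeping).** For a finite law `μ` on
configurations with finite unit-cube intensity `E_μ[#{p : p.1 ∈ [0,1)³}] < ∞`, a continuous `|G| ≤ K`, a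
continuous position cutoff `0 ≤ ψ ≤ 1` supported in the cube and equal to `1` on the cube off a measurable
exceptional set `S ⊆ [0,1)³`, and a continuous compactly supported velocity cutoff `0 ≤ χ ≤ 1` equal to `1` on the
ball of radius `R`: the window functional `ω ↦ Σ_{p ∈ ω, p.1 ∈ [0,1)³} G(p)` is `μ`-integrable and differs in
`μ`-mean from the linear statistic of `h(p) = ψ(p.1) χ(p.2) G(p)` by at most
`K (E_μ[#{p.1 ∈ S}] + E_μ[#{p.1 ∈ [0,1)³, R < ‖p.2‖}])` (pointwise on the full-measure event of finitely many
particles above the cube: `|G − h| ≤ K (1_S(p.1) + 1_{R < ‖p.2‖})` there, `h = 0` off the cube). -/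
theorem windowSum_approx (μ : Measure (PointConfig (V3 × V3))) [IsFiniteMeasure μ]
    (hfin : ∫⁻ ω, ((ω.count (unitCube (Fin 3) ×ˢ (univ : Set V3)) : ℕ∞) : ℝ≥0∞) ∂μ ≠ ⊤)
    {G : V3 × V3 → ℝ} (hG : Continuous G) {K : ℝ} (hGK : ∀ p, |G p| ≤ K)
    {ψ : V3 → ℝ} (hψ : Continuous ψ) (hψ0 : ∀ y, 0 ≤ ψ y) (hψ1 : ∀ y, ψ y ≤ 1)
    (hψsupp : Function.support ψ ⊆ unitCube (Fin 3))
    {S : Set V3} (hS : MeasurableSet S) (hSc : S ⊆ unitCube (Fin 3))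
    (hψS : ∀ y ∈ unitCube (Fin 3), y ∉ S → ψ y = 1)
    {χ : V3 → ℝ} (hχ : Continuous χ) (hχ0 : ∀ v, 0 ≤ χ v) (hχ1 : ∀ v, χ v ≤ 1)
    {R : ℝ} (hχR : ∀ v, ‖v‖ ≤ R → χ v = 1) :
    Integrable (fun ω => windowSumReal ω (unitCube (Fin 3)) G) μ ∧
      |(∫ ω, windowSumReal ω (unitCube (Fin 3)) G ∂μ) - ∫ ω, ω.sumFn (fun p => ψ p.1 * (χ p.2 * G p)) ∂μ| ≤
        K * ((∫⁻ ω, ((ω.count (S ×ˢ (univ : Set V3)) : ℕ∞) : ℝ≥0∞) ∂μ).toReal +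
          (∫⁻ ω, ((ω.count (unitCube (Fin 3) ×ˢ {v : V3 | R < ‖v‖}) : ℕ∞) : ℝ≥0∞) ∂μ).toReal) := by
  classical
  have hK0 : 0 ≤ K := (abs_nonneg _).trans (hGK (0, 0))
  -- the three counting functionals
  set C : Set (V3 × V3) := unitCube (Fin 3) ×ˢ (univ : Set V3) with hCdef
  set CS : Set (V3 × V3) := S ×ˢ (univ : Set V3) with hCSdef
  set CT : Set (V3 × V3) := unitCube (Fin 3) ×ˢ {v : V3 | R < ‖v‖} with hCTdef
  have hTm : MeasurableSet {v : V3 | R < ‖v‖} := measurableSet_lt measurable_const continuous_norm.measurable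
  have hCm : MeasurableSet C := measurableSet_unitCube.prod MeasurableSet.univ
  have hCSm : MeasurableSet CS := hS.prod MeasurableSet.univ
  have hCTm : MeasurableSet CT := measurableSet_unitCube.prod hTm
  have hC1 : ∀ p ∈ C, p.1 ∈ unitCube (Fin 3) := fun p hp => hp.1
  have hCS1 : ∀ p ∈ CS, p.1 ∈ unitCube (Fin 3) := fun p hp => hSc hp.1
  have hCT1 : ∀ p ∈ CT, p.1 ∈ unitCube (Fin 3) := fun p hp => hp.1
  have hCSC : CS ⊆ C := fun p hp => ⟨hSc hp.1, mem_univ _⟩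
  have hCTC : CT ⊆ C := fun p hp => ⟨hp.1, mem_univ _⟩
  set cC : PointConfig (V3 × V3) → ℝ≥0∞ := fun ω => ((ω.count C : ℕ∞) : ℝ≥0∞) with hcC
  set cS : PointConfig (V3 × V3) → ℝ≥0∞ := fun ω => ((ω.count CS : ℕ∞) : ℝ≥0∞) with hcS
  set cT : PointConfig (V3 × V3) → ℝ≥0∞ := fun ω => ((ω.count CT : ℕ∞) : ℝ≥0∞) with hcT
  have hmeas_count : ∀ {s : Set (V3 × V3)}, MeasurableSet s →
      Measurable fun ω : PointConfig (V3 × V3) => ((ω.count s : ℕ∞) : ℝ≥0∞) := fun hs =>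
    measurable_from_top.comp (Literature.Analysis.FunctionSpaces.PointConfig.measurable_count hs)
  have hcCm : Measurable cC := hmeas_count hCm
  have hcSm : Measurable cS := hmeas_count hCSm
  have hcTm : Measurable cT := hmeas_count hCTm
  have hcS_le : ∀ ω, cS ω ≤ cC ω := fun ω => by
    simp only [hcS, hcC, ENat.toENNReal_le]
    exact Literature.Analysis.FunctionSpaces.PointConfig.count_mono ω hCSC
  have hcT_le : ∀ ω, cT ω ≤ cC ω := fun ω => by
    simp only [hcT, hcC, ENat.toENNReal_le]
    exact Literature.Analysis.FunctionSpaces.PointConfig.count_mono ω hCTC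
  have hfinS : ∫⁻ ω, cS ω ∂μ ≠ ⊤ := ne_top_of_le_ne_top hfin (lintegral_mono hcS_le)
  have hfinT : ∫⁻ ω, cT ω ∂μ ≠ ⊤ := ne_top_of_le_ne_top hfin (lintegral_mono hcT_le)
  -- the good event: finitely many particles above the cube
  have hae : ∀ᵐ ω ∂μ, cC ω < ⊤ := ae_lt_top hcCm hfin
  have hgood : ∀ ω, cC ω < ⊤ → (particlesIn ω (unitCube (Fin 3))).Finite := by
    intro ω hω
    simp only [hcC, ENat.toENNReal_lt_top] at hω
    have h : (ω.carrier ∩ C).encard < ⊤ := hω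
    rw [Set.encard_lt_top_iff] at h
    rw [particlesIn_eq, ← Set.prod_univ]
    exact h
  -- the test function and its support
  set h : V3 × V3 → ℝ := fun p => ψ p.1 * (χ p.2 * G p) with hhdef
  have hh_cube : ∀ p, h p ≠ 0 → p.1 ∈ unitCube (Fin 3) := fun p hp =>
    hψsupp (Function.mem_support.2 (left_ne_zero_of_mul hp))
  have hhG : ∀ p, |h p| ≤ |G p| := fun p => by
    show |ψ p.1 * (χ p.2 * G p)| ≤ |G p|
    rw [abs_mul, abs_mul, abs_of_nonneg (hψ0 _), abs_of_nonneg (hχ0 _), ← mul_assoc]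
    exact mul_le_of_le_one_left (abs_nonneg _) (mul_le_one₀ (hψ1 _) (hχ0 _) (hχ1 _))
  -- measurable versions of the two functionals
  set uG : V3 × V3 → ℝ := fun p => (Prod.fst ⁻¹' unitCube (Fin 3)).indicator G p with huG
  have huGm : Measurable uG := hG.measurable.indicator (measurableSet_unitCube.preimage measurable_fst)
  have huG_cube : ∀ p, uG p ≠ 0 → p.1 ∈ unitCube (Fin 3) := fun p hp =>
    show p ∈ Prod.fst ⁻¹' unitCube (Fin 3) from
      Set.mem_of_indicator_ne_zero (s := Prod.fst ⁻¹' unitCube (Fin 3)) (f := G) hp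
  have hhm : Measurable h :=
    (hψ.measurable.comp measurable_fst).mul ((hχ.measurable.comp measurable_snd).mul hG.measurable)
  -- pointwise identities on the good event
  have hW_eq : ∀ ω, cC ω < ⊤ → windowSumReal ω (unitCube (Fin 3)) G =
      (∑' p : (ω : Set (V3 × V3)), ENNReal.ofReal (max (uG p) 0)).toReal -
        (∑' p : (ω : Set (V3 × V3)), ENNReal.ofReal (max (-uG p) 0)).toReal := by
    intro ω hω
    rw [tsum_posPart_sub_eq_sum (hgood ω hω) huG_cube, windowSumReal_eq_sum (hgood ω hω)]
    refine Finset.sum_congr rfl fun p hp => ?_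
    rw [(hgood ω hω).mem_toFinset, mem_particlesIn_iff] at hp
    show G p = (Prod.fst ⁻¹' unitCube (Fin 3)).indicator G p
    rw [Set.indicator_of_mem (show p ∈ Prod.fst ⁻¹' unitCube (Fin 3) from hp.2)]
  have hV_eq : ∀ ω, cC ω < ⊤ → ω.sumFn h =
      (∑' p : (ω : Set (V3 × V3)), ENNReal.ofReal (max (h p) 0)).toReal -
        (∑' p : (ω : Set (V3 × V3)), ENNReal.ofReal (max (-h p) 0)).toReal := by
    intro ω hω
    rw [tsum_posPart_sub_eq_sum (hgood ω hω) hh_cube, sumFn_eq_sum_particlesIn (hgood ω hω) hh_cube]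
  have hW_aesm : AEStronglyMeasurable (fun ω => windowSumReal ω (unitCube (Fin 3)) G) μ :=
    (measurable_tsum_posPart_sub huGm).aestronglyMeasurable.congr
      (hae.mono fun ω hω => (hW_eq ω hω).symm)
  have hV_aesm : AEStronglyMeasurable (fun ω : PointConfig (V3 × V3) => ω.sumFn h) μ :=
    (measurable_tsum_posPart_sub hhm).aestronglyMeasurable.congr (hae.mono fun ω hω => (hV_eq ω hω).symm)
  -- pointwise bounds on the good event
  have hW_bd : ∀ ω, cC ω < ⊤ → |windowSumReal ω (unitCube (Fin 3)) G| ≤ K * (cC ω).toReal := by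
    intro ω hω
    rw [windowSumReal_eq_sum (hgood ω hω), toReal_count_eq_sum_indicator (hgood ω hω) hC1, Finset.mul_sum]
    refine (Finset.abs_sum_le_sum_abs _ _).trans (Finset.sum_le_sum fun p hp => ?_)
    rw [(hgood ω hω).mem_toFinset, mem_particlesIn_iff] at hp
    rw [Set.indicator_of_mem (show p ∈ C from ⟨hp.2, mem_univ _⟩), mul_one]
    exact hGK p
  have hV_bd : ∀ ω, cC ω < ⊤ → |ω.sumFn h| ≤ K * (cC ω).toReal := by
    intro ω hω
    rw [sumFn_eq_sum_particlesIn (hgood ω hω) hh_cube, toReal_count_eq_sum_indicator (hgood ω hω) hC1,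
      Finset.mul_sum]
    refine (Finset.abs_sum_le_sum_abs _ _).trans (Finset.sum_le_sum fun p hp => ?_)
    rw [(hgood ω hω).mem_toFinset, mem_particlesIn_iff] at hp
    rw [Set.indicator_of_mem (show p ∈ C from ⟨hp.2, mem_univ _⟩), mul_one]
    exact (hhG p).trans (hGK p)
  have hdiff_bd : ∀ ω, cC ω < ⊤ →
      |windowSumReal ω (unitCube (Fin 3)) G - ω.sumFn h| ≤ K * ((cS ω).toReal + (cT ω).toReal) := by
    intro ω hω
    rw [windowSumReal_eq_sum (hgood ω hω), sumFn_eq_sum_particlesIn (hgood ω hω) hh_cube,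
      toReal_count_eq_sum_indicator (hgood ω hω) hCS1, toReal_count_eq_sum_indicator (hgood ω hω) hCT1,
      ← Finset.sum_sub_distrib, ← Finset.sum_add_distrib, Finset.mul_sum]
    refine (Finset.abs_sum_le_sum_abs _ _).trans (Finset.sum_le_sum fun p hp => ?_)
    rw [(hgood ω hω).mem_toFinset, mem_particlesIn_iff] at hp
    have hfac : G p - h p = G p * (1 - ψ p.1 * χ p.2) := by rw [hhdef]; ring
    have h01 : 0 ≤ 1 - ψ p.1 * χ p.2 ∧ 1 - ψ p.1 * χ p.2 ≤ 1 :=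
      ⟨sub_nonneg.2 (mul_le_one₀ (hψ1 _) (hχ0 _) (hχ1 _)), by linarith [mul_nonneg (hψ0 p.1) (hχ0 p.2)]⟩
    rw [hfac, abs_mul]
    by_cases hpS : p.1 ∈ S
    · rw [Set.indicator_of_mem (show p ∈ CS from ⟨hpS, mem_univ _⟩)]
      calc |G p| * |1 - ψ p.1 * χ p.2| ≤ K * 1 :=
            mul_le_mul (hGK p) (by rw [abs_of_nonneg h01.1]; exact h01.2) (abs_nonneg _) hK0
        _ ≤ K * (1 + CT.indicator (fun _ => (1 : ℝ)) p) := by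
            gcongr
            linarith [Set.indicator_nonneg (fun _ _ => (zero_le_one : (0 : ℝ) ≤ 1)) (s := CT) p]
    · rw [hψS p.1 hp.2 hpS, one_mul]
      by_cases hpR : ‖p.2‖ ≤ R
      · rw [hχR _ hpR, sub_self, abs_zero, mul_zero]
        exact mul_nonneg hK0 (add_nonneg (Set.indicator_nonneg (fun _ _ => zero_le_one) _)
          (Set.indicator_nonneg (fun _ _ => zero_le_one) _))
      · rw [Set.indicator_of_mem (show p ∈ CT from ⟨hp.2, not_le.1 hpR⟩)]
        calc |G p| * |1 - χ p.2| ≤ K * 1 :=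
              mul_le_mul (hGK p) (by rw [abs_of_nonneg (sub_nonneg.2 (hχ1 _))]; linarith [hχ0 p.2])
                (abs_nonneg _) hK0
          _ ≤ K * (CS.indicator (fun _ => (1 : ℝ)) p + 1) := by
              gcongr
              linarith [Set.indicator_nonneg (fun _ _ => (zero_le_one : (0 : ℝ) ≤ 1)) (s := CS) p]
  -- integrability
  have hcC_int : Integrable (fun ω => (cC ω).toReal) μ := integrable_toReal_of_lintegral_ne_top hcCm.aemeasurable hfin
  have hcS_int : Integrable (fun ω => (cS ω).toReal) μ :=
    integrable_toReal_of_lintegral_ne_top hcSm.aemeasurable hfinS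
  have hcT_int : Integrable (fun ω => (cT ω).toReal) μ :=
    integrable_toReal_of_lintegral_ne_top hcTm.aemeasurable hfinT
  have hWi : Integrable (fun ω => windowSumReal ω (unitCube (Fin 3)) G) μ :=
    (hcC_int.const_mul K).mono' hW_aesm (hae.mono fun ω hω => by rw [Real.norm_eq_abs]; exact hW_bd ω hω)
  have hVi : Integrable (fun ω : PointConfig (V3 × V3) => ω.sumFn h) μ :=
    (hcC_int.const_mul K).mono' hV_aesm (hae.mono fun ω hω => by rw [Real.norm_eq_abs]; exact hV_bd ω hω)
  refine ⟨hWi, ?_⟩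
  -- the comparison of the means
  rw [← integral_sub hWi hVi, ← Real.norm_eq_abs]
  refine (norm_integral_le_of_norm_le (g := fun ω => K * ((cS ω).toReal + (cT ω).toReal))
    ((hcS_int.add hcT_int).const_mul K)
    (hae.mono fun ω hω => by rw [Real.norm_eq_abs]; exact hdiff_bd ω hω)).trans (le_of_eq ?_)
  rw [integral_const_mul, integral_add (f := fun ω => (cS ω).toReal) (g := fun ω => (cT ω).toReal) hcS_int hcT_int,
    integral_toReal hcSm.aemeasurable
    (hae.mono fun ω hω => lt_of_le_of_lt (hcS_le ω) hω), integral_toReal hcTm.aemeasurable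
    (hae.mono fun ω hω => lt_of_le_of_lt (hcT_le ω) hω)]

/-- Registered stub `stub_windowSum_approx` (line `FirstLemma`, helper of `stub_tangentBias`): the window functional is
approximated by `C_c` linear statistics (= `windowSum_approx`). -/
theorem stub_windowSum_approx (μ : Measure (PointConfig (V3 × V3))) [IsFiniteMeasure μ]
    (hfin : ∫⁻ ω, ((ω.count (unitCube (Fin 3) ×ˢ (univ : Set V3)) : ℕ∞) : ℝ≥0∞) ∂μ ≠ ⊤)
    {G : V3 × V3 → ℝ} (hG : Continuous G) {K : ℝ} (hGK : ∀ p, |G p| ≤ K)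
    {ψ : V3 → ℝ} (hψ : Continuous ψ) (hψ0 : ∀ y, 0 ≤ ψ y) (hψ1 : ∀ y, ψ y ≤ 1)
    (hψsupp : Function.support ψ ⊆ unitCube (Fin 3))
    {S : Set V3} (hS : MeasurableSet S) (hSc : S ⊆ unitCube (Fin 3))
    (hψS : ∀ y ∈ unitCube (Fin 3), y ∉ S → ψ y = 1)
    {χ : V3 → ℝ} (hχ : Continuous χ) (hχ0 : ∀ v, 0 ≤ χ v) (hχ1 : ∀ v, χ v ≤ 1)
    {R : ℝ} (hχR : ∀ v, ‖v‖ ≤ R → χ v = 1) :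
    Integrable (fun ω => windowSumReal ω (unitCube (Fin 3)) G) μ ∧
      |(∫ ω, windowSumReal ω (unitCube (Fin 3)) G ∂μ) - ∫ ω, ω.sumFn (fun p => ψ p.1 * (χ p.2 * G p)) ∂μ| ≤
        K * ((∫⁻ ω, ((ω.count (S ×ˢ (univ : Set V3)) : ℕ∞) : ℝ≥0∞) ∂μ).toReal +
          (∫⁻ ω, ((ω.count (unitCube (Fin 3) ×ˢ {v : V3 | R < ‖v‖}) : ℕ∞) : ℝ≥0∞) ∂μ).toReal) :=
  windowSum_approx μ hfin hG hGK hψ hψ0 hψ1 hψsupp hS hSc hψS hχ hχ0 hχ1 hχR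

end Summit.AtomisticToContinuum.HydrodynamicLimit.Theorems.KiferCompactification
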